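import Literature.NumberTheory.EllipticCurves.HalfIntegralWeightGaussSumsOdd
import HarnessLib

/-!
# Quadratic Gauss sums at powers of `2` and the relation `G(a; 2m) = √2 χ₈(a) G(a; m)`

Third file on `quadGaussSum c a k = G(a, k; c) = ∑_{r mod c} e((a r² + k r)/c)`. We PROVE:

* `quadGaussSum_four_eq`, `quadGaussSum_eight_eq` — the values `G(b; 4) = 2(1 + ψ₄(b))`,
  `G(b; 8) = 4 ψ₈(b)` for odd `b` (`ψ_N = e(·/N)`), and `quadGaussSum_eight_eq_sqrt_two_mul` —
  **`G(b; 8) = √2 χ₈(b) G(b; 4)`** for odd `b` (`χ₈` Mathlib's primitive character modulo `8`,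
  the Kronecker symbol `(2/·)`; four numerical identities in `ℚ(ζ₈)`).
* `quadGaussSum_two_pow_succ` — **`G(b; 2^{k+1}) = √2 χ₈(b) G(b; 2^k)`** for `k ≥ 2`, `b` odd
  (from the case `k = 2` and `G(b; 4m) = 2 G(b; m)`, `HalfIntegralWeightGaussSums`).
* `quadGaussSum_two_mul` — **`G(a; 2m) = √2 χ₈(a) G(a; m)` for `4 ∣ m` and `gcd(a, 2m) = 1`**:
  factor `m = 2^k n`, `n` odd; by multiplicativity (`quadGaussSum_mul_of_coprime`)
  `G(a; 2^{k+1} n)/G(a; 2^k n) = [G(na; 2^{k+1})/G(na; 2^k)] · [G(2^{k+1} a; n)/G(2^k a; n)]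
  = √2 χ₈(na) · χ₈(n) = √2 χ₈(a)` (`quadGaussSum_two_mul_left`: `G(2b; n) = χ₈(n) G(b; n)`).

This is the Gauss-sum identity behind `θ(2γz) θ(z) = χ₈(d) θ(γz) θ(2z)` for `γ ∈ Γ₀(8)` (sequel),
i.e. behind the character `χ₈ = (2/·)` of `θ(2z)` as a form of weight `1/2` on `Γ₀(8)`
(Shimura 1973, Prop. 2.2 context; Koblitz IV §1). Versions with the modulus given by an equation
(`quadGaussSum_four_mul'`, `quadGaussSum_mul_of_coprime'`) are recorded to rewrite under moduli such
as `2^(k+2) = 4 · 2^k` without dependent-type friction.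

## References

* G. Shimura, *On modular forms of half integral weight*, Ann. of Math. 97 (1973), §1–2.
* N. Koblitz, *Introduction to Elliptic Curves and Modular Forms*, GTM 97 (1993), Ch. IV §1.
* H. Iwaniec, E. Kowalski, *Analytic Number Theory* (2004), §3.4–3.5.
-/

noncomputable section

open Complex Finset

namespace Literature.NumberTheory.EllipticCurves.ModularForms

open Literature.NumberTheory.LFunctions (stdAddChar_natCast sum_zmod_eq_sum_range)

/-! ### Moduli given by an equation -/

/-- `G(a; c) = 2 G(a; m)` for `c = 4m`, `4 ∣ m`, `a` odd (`quadGaussSum_four_mul` with the modulus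
as an equation). [folklore] -/
theorem quadGaussSum_four_mul' {c m : ℕ} [NeZero c] [NeZero m] (hc : c = 4 * m) (hm4 : 4 ∣ m)
    {a : ℤ} (ha : Odd a) : quadGaussSum c a 0 = 2 * quadGaussSum m a 0 := by
  subst hc
  exact quadGaussSum_four_mul m hm4 ha

/-- `G(a; c) = G(c₂ a; c₁) G(c₁ a; c₂)` for `c = c₁c₂` with `c₁, c₂` coprime
(`quadGaussSum_mul_of_coprime` with the modulus as an equation). [folklore] -/
theorem quadGaussSum_mul_of_coprime' {c c₁ c₂ : ℕ} [NeZero c] [NeZero c₁] [NeZero c₂]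
    (hc : c = c₁ * c₂) (h : c₁.Coprime c₂) (a : ℤ) :
    quadGaussSum c a 0 =
      quadGaussSum c₁ ((c₂ * a : ℤ) : ZMod c₁) 0 * quadGaussSum c₂ ((c₁ * a : ℤ) : ZMod c₂) 0 := by
  subst hc
  exact quadGaussSum_mul_of_coprime h a

/-! ### The values at `4` and `8` -/

/-- `∑_{r mod 4} ψ₄(u r²) = 2 ψ₄(0) + 2 ψ₄(u)` (`r² ∈ {0, 1}` modulo `4`). [folklore] -/
theorem quadGaussSum_four_eq (u : ZMod 4) :
    quadGaussSum 4 u 0 = 2 + 2 * (ZMod.stdAddChar u : ℂ) := by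
  rw [quadGaussSum_def, sum_zmod_eq_sum_range]
  simp only [Finset.sum_range_succ, Finset.sum_range_zero, zero_add, Nat.cast_zero, Nat.cast_one,
    Nat.cast_ofNat, zero_mul, add_zero]
  have h2 : (2 : ZMod 4) ^ 2 = 0 := by decide
  have h3 : (3 : ZMod 4) ^ 2 = 1 := by decide
  rw [h2, h3, zero_pow two_ne_zero, one_pow, mul_zero, mul_one, AddChar.map_zero_eq_one]
  ring

/-- `∑_{r mod 8} ψ₈(u r²) = 2 ψ₈(0) + 4 ψ₈(u) + 2 ψ₈(4u)` (`r² ∈ {0, 1, 4}` modulo `8`). [folklore] -/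
theorem quadGaussSum_eight_eq' (u : ZMod 8) :
    quadGaussSum 8 u 0 = 2 + 4 * (ZMod.stdAddChar u : ℂ) + 2 * (ZMod.stdAddChar (4 * u) : ℂ) := by
  rw [quadGaussSum_def, sum_zmod_eq_sum_range]
  simp only [Finset.sum_range_succ, Finset.sum_range_zero, zero_add, Nat.cast_zero, Nat.cast_one,
    Nat.cast_ofNat, zero_mul, add_zero]
  have h2 : (2 : ZMod 8) ^ 2 = 4 := by decide
  have h3 : (3 : ZMod 8) ^ 2 = 1 := by decide
  have h4 : (4 : ZMod 8) ^ 2 = 0 := by decide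
  have h5 : (5 : ZMod 8) ^ 2 = 1 := by decide
  have h6 : (6 : ZMod 8) ^ 2 = 4 := by decide
  have h7 : (7 : ZMod 8) ^ 2 = 1 := by decide
  rw [h2, h3, h4, h5, h6, h7, zero_pow two_ne_zero, one_pow, mul_zero, mul_one,
    AddChar.map_zero_eq_one, mul_comm u 4]
  ring

/-- `ψ₈(4) = -1`. [folklore] -/
theorem stdAddChar_eight_four : (ZMod.stdAddChar (4 : ZMod 8) : ℂ) = -1 := by
  have := stdAddChar_half (c := 8) ⟨4, rfl⟩
  norm_num at this
  exact this

/-- `ψ₈(1) = e^{πi/4} = (1 + i) √2/2`. [folklore] -/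
theorem stdAddChar_eight_one :
    (ZMod.stdAddChar (1 : ZMod 8) : ℂ) = (1 + I) * (Real.sqrt 2 / 2 : ℝ) := by
  have h := stdAddChar_natCast 8 1
  rw [Nat.cast_one] at h
  rw [h, show 2 * (Real.pi : ℂ) * I * ((1 : ℕ) : ℂ) / ((8 : ℕ) : ℂ) = ((Real.pi / 4 : ℝ) : ℂ) * I by
    push_cast; ring, Complex.exp_mul_I, ← Complex.ofReal_cos, ← Complex.ofReal_sin,
    Real.cos_pi_div_four, Real.sin_pi_div_four]
  push_cast
  ring

/-- `ψ₈(2) = i`. [folklore] -/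
theorem stdAddChar_eight_two : (ZMod.stdAddChar (2 : ZMod 8) : ℂ) = I := by
  have h := stdAddChar_natCast 8 2
  rw [Nat.cast_ofNat] at h
  rw [h, show 2 * (Real.pi : ℂ) * I * ((2 : ℕ) : ℂ) / ((8 : ℕ) : ℂ) = Real.pi / 2 * I by
    push_cast; ring, Complex.exp_pi_div_two_mul_I]

/-- `ψ₄(1) = i`. [folklore] -/
theorem stdAddChar_four_one : (ZMod.stdAddChar (1 : ZMod 4) : ℂ) = I := by
  have h := stdAddChar_natCast 4 1
  rw [Nat.cast_one] at h
  rw [h, show 2 * (Real.pi : ℂ) * I * ((1 : ℕ) : ℂ) / ((4 : ℕ) : ℂ) = Real.pi / 2 * I by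
    push_cast; ring, Complex.exp_pi_div_two_mul_I]

/-- `ψ₄(2) = -1`. [folklore] -/
theorem stdAddChar_four_two : (ZMod.stdAddChar (2 : ZMod 4) : ℂ) = -1 := by
  have := stdAddChar_half (c := 4) ⟨2, rfl⟩
  norm_num at this
  exact this

/-- `√2 · ψ₈(1) = 1 + i`. [folklore] -/
theorem sqrt_two_mul_stdAddChar_eight_one :
    (Real.sqrt 2 : ℂ) * (ZMod.stdAddChar (1 : ZMod 8) : ℂ) = 1 + I := by
  have hss : (Real.sqrt 2 : ℂ) * Real.sqrt 2 = 2 := by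
    rw [← Complex.ofReal_mul, Real.mul_self_sqrt zero_le_two]; norm_num
  rw [stdAddChar_eight_one]
  push_cast
  linear_combination ((1 + I) / 2) * hss

/-- **`G(b; 8) = √2 χ₈(b) G(b; 4)` for odd `b`** (four identities in `ℤ[i]` after multiplying by
`√2`, one for each odd class modulo `8`: e.g. `√2 G(1; 8) = 4 √2 ζ₈ = 4 (1 + i) = 2 χ₈(1) G(1; 4)`).
[folklore] -/
theorem quadGaussSum_eight_eq_sqrt_two_mul {b : ℤ} (hb : Odd b) :
    quadGaussSum 8 b 0 = Real.sqrt 2 * ZMod.χ₈ b * quadGaussSum 4 b 0 := by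
  have hss : (Real.sqrt 2 : ℂ) * Real.sqrt 2 = 2 := by
    rw [← Complex.ofReal_mul, Real.mul_self_sqrt zero_le_two]; norm_num
  have hs0 : (Real.sqrt 2 : ℂ) ≠ 0 := by
    exact_mod_cast (Real.sqrt_pos.mpr two_pos).ne'
  have h1 := sqrt_two_mul_stdAddChar_eight_one
  have I_sq : I ^ 2 = -1 := Complex.I_sq
  -- reduce to `b mod 8 ∈ {1, 3, 5, 7}`
  obtain ⟨r, hr⟩ : ∃ r : ℤ, b % 8 = r := ⟨_, rfl⟩
  have hb8 : b = 8 * (b / 8) + r := by omega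
  have hcases : r = 1 ∨ r = 3 ∨ r = 5 ∨ r = 7 := by
    have := Int.odd_iff.mp hb; omega
  have e8 : (b : ZMod 8) = (r : ZMod 8) := by
    rw [hb8]; push_cast
    rw [show (8 : ZMod 8) = 0 from rfl, zero_mul, zero_add]
  have e4 : (b : ZMod 4) = (r : ZMod 4) := by
    rw [hb8]; push_cast
    rw [show (8 : ZMod 4) = 0 from rfl, zero_mul, zero_add]
  -- the key identity `√2 G(r; 8) = 2 χ₈(r) G(r; 4)` in the four cases
  have key : (Real.sqrt 2 : ℂ) * quadGaussSum 8 r 0 = 2 * ZMod.χ₈ r * quadGaussSum 4 r 0 := by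
    rcases hcases with rfl | rfl | rfl | rfl
    · simp only [Int.cast_one]
      rw [quadGaussSum_eight_eq', quadGaussSum_four_eq, mul_one, stdAddChar_eight_four,
        stdAddChar_four_one, show ZMod.χ₈ (1 : ZMod 8) = 1 from rfl]
      push_cast
      linear_combination 4 * h1
    · simp only [Int.cast_ofNat]
      rw [quadGaussSum_eight_eq', quadGaussSum_four_eq, show (4 * 3 : ZMod 8) = 4 from rfl,
        show (3 : ZMod 8) = 1 + 2 from rfl, show (3 : ZMod 4) = 1 + 2 from rfl,
        AddChar.map_add_eq_mul, AddChar.map_add_eq_mul, stdAddChar_eight_four,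
        stdAddChar_eight_two, stdAddChar_four_one, stdAddChar_four_two,
        show ZMod.χ₈ ((1 + 2 : ZMod 8)) = -1 from rfl]
      push_cast
      linear_combination (4 * I) * h1 + 4 * I_sq
    · simp only [Int.cast_ofNat]
      rw [quadGaussSum_eight_eq', quadGaussSum_four_eq, show (4 * 5 : ZMod 8) = 4 from rfl,
        show (5 : ZMod 8) = 1 + 4 from rfl, show (5 : ZMod 4) = 1 from rfl,
        AddChar.map_add_eq_mul, stdAddChar_eight_four, stdAddChar_four_one,
        show ZMod.χ₈ ((1 + 4 : ZMod 8)) = -1 from rfl]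
      push_cast
      linear_combination (-4) * h1
    · simp only [Int.cast_ofNat]
      rw [quadGaussSum_eight_eq', quadGaussSum_four_eq, show (4 * 7 : ZMod 8) = 4 from rfl,
        show (7 : ZMod 8) = 1 + 2 + 4 from rfl, show (7 : ZMod 4) = 1 + 2 from rfl,
        AddChar.map_add_eq_mul, AddChar.map_add_eq_mul, AddChar.map_add_eq_mul,
        stdAddChar_eight_four, stdAddChar_eight_two, stdAddChar_four_one, stdAddChar_four_two,
        show ZMod.χ₈ ((1 + 2 + 4 : ZMod 8)) = 1 from rfl]
      push_cast
      linear_combination (-4 * I) * h1 - 4 * I_sq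
  rw [e8, e4]
  apply mul_left_cancel₀ hs0
  rw [key]
  linear_combination (-(((ZMod.χ₈ (r : ZMod 8) : ℤ) : ℂ) * quadGaussSum 4 r 0)) * hss

/-! ### Powers of `2` -/

/-- `χ₈(b)² = 1` for odd `b`. [folklore] -/
theorem χ₈_sq_of_odd {b : ℤ} (hb : Odd b) : ((ZMod.χ₈ b : ℤ) : ℂ) ^ 2 = 1 := by
  rw [ZMod.χ₈_int_eq_if_mod_eight]
  have : b % 2 = 1 := Int.odd_iff.mp hb
  rw [if_neg (by omega)]
  split_ifs <;> norm_num

/-- **`G(b; 2^{k+1}) = √2 χ₈(b) G(b; 2^k)` for `k ≥ 2` and odd `b`** (the case `k = 2` is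
`quadGaussSum_eight_eq_sqrt_two_mul`; then use `G(b; 4m) = 2 G(b; m)`). [folklore] -/
theorem quadGaussSum_two_pow_succ {k : ℕ} (hk : 2 ≤ k) {b : ℤ} (hb : Odd b) :
    quadGaussSum (2 ^ (k + 1)) b 0 = Real.sqrt 2 * ZMod.χ₈ b * quadGaussSum (2 ^ k) b 0 := by
  induction k using Nat.strong_induction_on with
  | _ k ih =>
    rcases Nat.lt_or_ge k 4 with hk4 | hk4
    · interval_cases k
      · -- `k = 2`
        have h8 : quadGaussSum (2 ^ (2 + 1)) b 0 = quadGaussSum 8 b 0 := rfl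
        have h4 : quadGaussSum (2 ^ 2) b 0 = quadGaussSum 4 b 0 := rfl
        rw [h8, h4]
        exact quadGaussSum_eight_eq_sqrt_two_mul hb
      · -- `k = 3`: `G(b; 16) = 2 G(b; 4)` and `G(b; 8) = √2 χ₈(b) G(b; 4)`
        have h16 : quadGaussSum (2 ^ (3 + 1)) b 0 = 2 * quadGaussSum 4 b 0 :=
          quadGaussSum_four_mul' (m := 4) rfl (dvd_refl 4) hb
        have h8 : quadGaussSum (2 ^ 3) b 0 = quadGaussSum 8 b 0 := rfl
        rw [h16, h8, quadGaussSum_eight_eq_sqrt_two_mul hb]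
        have hss : (Real.sqrt 2 : ℂ) * Real.sqrt 2 = 2 := by
          rw [← Complex.ofReal_mul, Real.mul_self_sqrt zero_le_two]; norm_num
        linear_combination (-(((ZMod.χ₈ (b : ZMod 8) : ℤ) : ℂ) ^ 2 * quadGaussSum 4 (b : ZMod 4) 0)) * hss
          - (2 * quadGaussSum 4 (b : ZMod 4) 0) * χ₈_sq_of_odd hb
    · -- `k ≥ 4`: reduce to `k - 2`
      obtain ⟨j, rfl⟩ : ∃ j, k = j + 2 := ⟨k - 2, by omega⟩
      have hj : 2 ≤ j := by omega
      have hA : quadGaussSum (2 ^ (j + 2 + 1)) b 0 = 2 * quadGaussSum (2 ^ (j + 1)) b 0 :=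
        quadGaussSum_four_mul' (m := 2 ^ (j + 1)) (by ring) (by
          rw [show (4 : ℕ) = 2 ^ 2 by norm_num]; exact Nat.pow_dvd_pow 2 (by omega)) hb
      have hB : quadGaussSum (2 ^ (j + 2)) b 0 = 2 * quadGaussSum (2 ^ j) b 0 :=
        quadGaussSum_four_mul' (m := 2 ^ j) (by ring) (by
          rw [show (4 : ℕ) = 2 ^ 2 by norm_num]; exact Nat.pow_dvd_pow 2 hj) hb
      rw [hA, hB, ih j (by omega) hj]
      ring

/-! ### `G(a; 2m) = √2 χ₈(a) G(a; m)` -/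

/-- **`G(a; 2m) = √2 χ₈(a) G(a; m)` for `4 ∣ m` and `a` coprime to `2m`** — the Gauss-sum
identity behind `θ(2γz) θ(z) = χ₈(d) θ(γz) θ(2z)` on `Γ₀(8)`. Proof: `m = 2^k n` with `n` odd,
`k ≥ 2`; split both Gauss sums by `quadGaussSum_mul_of_coprime` and use
`quadGaussSum_two_pow_succ` (ratio `√2 χ₈(na)`) and `quadGaussSum_two_mul_left`
(ratio `χ₈(n)`). Stated with the modulus `c = 2m` as an equation. [folklore] -/
theorem quadGaussSum_two_mul {c m : ℕ} [NeZero c] [NeZero m] (hc : c = 2 * m) (hm4 : 4 ∣ m)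
    {a : ℤ} (ha : a.gcd c = 1) :
    quadGaussSum c a 0 = Real.sqrt 2 * ZMod.χ₈ a * quadGaussSum m a 0 := by
  obtain ⟨k, n, hn, rfl⟩ := Nat.exists_eq_two_pow_mul_odd (NeZero.ne m)
  haveI : NeZero n := ⟨fun h ↦ by simp [h] at hn⟩
  -- `k ≥ 2`
  have hk : 2 ≤ k := by
    by_contra hlt
    push Not at hlt
    have h4 : 4 ∣ 2 ^ k * n := hm4
    interval_cases k
    · rw [pow_zero, one_mul] at h4
      exact (Nat.not_even_iff_odd.mpr hn) (even_iff_two_dvd.mpr (dvd_trans ⟨2, rfl⟩ h4))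
    · rw [pow_one] at h4
      have : 2 ∣ n := by
        obtain ⟨q, hq⟩ := h4
        exact ⟨q, by omega⟩
      exact (Nat.not_even_iff_odd.mpr hn) (even_iff_two_dvd.mpr this)
  -- coprimality data
  have hodd_a : Odd a := by
    have h1 : IsCoprime a (c : ℤ) := Int.isCoprime_iff_gcd_eq_one.mpr ha
    rw [hc] at h1
    push_cast at h1
    have h2 : IsCoprime (2 : ℤ) a := h1.of_mul_right_left.symm
    have h3 : ¬ (2 : ℤ) ∣ a := Int.prime_two.coprime_iff_not_dvd.mp h2
    exact Int.not_even_iff_odd.mp (fun h ↦ h3 (even_iff_two_dvd.mp h))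
  have hcop : (2 ^ (k + 1)).Coprime n := (Nat.coprime_two_left.mpr hn).pow_left _
  have hcop' : (2 ^ k).Coprime n := (Nat.coprime_two_left.mpr hn).pow_left _
  have hna : Odd ((n : ℤ) * a) := by
    have : Odd (n : ℤ) := by exact_mod_cast hn
    exact this.mul hodd_a
  have hgcd : (2 ^ k * a : ℤ).gcd n = 1 := by
    have han : IsCoprime a (n : ℤ) := by
      have h1 : IsCoprime a (c : ℤ) := Int.isCoprime_iff_gcd_eq_one.mpr ha
      rw [hc] at h1
      push_cast at h1
      exact h1.of_mul_right_right.of_mul_right_right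
    have h2n : IsCoprime ((2 : ℤ) ^ k) n := by
      have : IsCoprime (2 : ℤ) n := by
        rw [Int.isCoprime_iff_gcd_eq_one]
        exact_mod_cast Nat.coprime_two_left.mpr hn
      exact this.pow_left
    exact Int.isCoprime_iff_gcd_eq_one.mp (h2n.mul_left han)
  -- split both sums
  rw [quadGaussSum_mul_of_coprime' (c₁ := 2 ^ (k + 1)) (c₂ := n) (by rw [hc]; ring) hcop a,
    quadGaussSum_mul_of_coprime' (c₁ := 2 ^ k) (c₂ := n) rfl hcop' a,
    quadGaussSum_two_pow_succ hk hna]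
  -- odd part: `G(2^{k+1} a; n) = χ₈(n) G(2^k a; n)`
  have hodd_part : quadGaussSum n (((2 ^ (k + 1) : ℕ) * a : ℤ) : ZMod n) 0 =
      ZMod.χ₈ n * quadGaussSum n (((2 ^ k : ℕ) * a : ℤ) : ZMod n) 0 := by
    rw [show (((2 ^ (k + 1) : ℕ) * a : ℤ)) = 2 * ((2 ^ k : ℕ) * a : ℤ) by push_cast; ring,
      quadGaussSum_two_mul_left hn (by exact_mod_cast hgcd)]
  rw [hodd_part]
  -- `χ₈(na) χ₈(n) = χ₈(a)`
  have hχ : ((ZMod.χ₈ (((n : ℤ) * a : ℤ) : ZMod 8) : ℤ) : ℂ) * ZMod.χ₈ n = ZMod.χ₈ a := by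
    have hn2 : ((ZMod.χ₈ (n : ℤ) : ℤ) : ℂ) ^ 2 = 1 := χ₈_sq_of_odd (by exact_mod_cast hn)
    push_cast
    rw [map_mul]
    push_cast
    rw [Int.cast_natCast] at hn2
    linear_combination ((ZMod.χ₈ (a : ZMod 8) : ℤ) : ℂ) * hn2
  linear_combination (Real.sqrt 2 * quadGaussSum (2 ^ k) (((n : ℤ) * a : ℤ) : ZMod (2 ^ k)) 0 *
    quadGaussSum n (((2 ^ k : ℕ) * a : ℤ) : ZMod n) 0) * hχ

end Literature.NumberTheory.EllipticCurves.ModularForms
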